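import Summits.QuantumFields.YangMills.Theorems.IsotropyFromPowerCountingCurvatureDensitiesTameSector
import Summits.QuantumFields.YangMills.Theorems.MirrorModularBoostsCurvatureBoostCovarianceDominatedTieLimit
import HarnessLib

/-!
# Tied families on the TAME SECTOR of Wilson schemes are of ORDER ZERO on all of `⁰𝒮`

Support file for the crux `MirrorModularBoosts.SoftKernelBoostCovariance` (stmt-QuantumFields-14999), line
`Sketch` (lead c9).  The crux is universally quantified over ALL sequential Wilson schemes
`sch = (a_k, β_k, L_k, c_k, m_k)`; its two residual stubs (`stub_regularHigh`, `stub_sandwichPair`) are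
statements about the Wilson limit `S₁`.  On the TAME SECTOR — schemes which, for infinitely many `k`, are at
zero coupling OR renormalise the curvature species multiplicatively below a fixed bound — the tied family is of
order zero with GEOMETRIC constants on the whole of `⁰𝒮`:

* `norm_schwinger_le_of_frequently_tame` — if `S₁` is tied to `(r, sch)` (first clause of `W1`) and
  `∃ B, ∃ᶠ k, β_k = 0 ∨ |c_k| ≤ B`, then there is `A ≥ 0` with `‖𝔖ₙ F‖ ≤ Aⁿ ∫ ‖F‖` for every `n ≥ 1` and
  every `F ∈ ⁰𝒮((ℝ⁴)ⁿ)` (not only real tensors).  Proof: along the subsequence scheme of tame steps (again a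
  scheme, inheriting the tie) the TRUE renormalised densities `c_kⁿ W_k` are bounded by `Aⁿ` at injective
  multi-sites, `A = |2BM + K| + |K| + 1` (`M` bounds the Wilson action density, `K` the renormalised mean
  `κ_k = c_k(⟨F⟩_k − m_k)`, bounded by the degree-one tie — landed `eventually_abs_renormalisedMean_le`,
  `abs_trueDensity_le`, `torusMoment_zero_coupling`); the landed dominated tie limit `stub_dominatedTieLimit`
  (p108509: flat decay + equicontinuity + density of off-diagonal tensors) with the CONSTANT weight `Aⁿ` gives the
  domination on all of `⁰𝒮`.
* `norm_schwinger_le_of_frequently_tame_of_W1` — the same from `W1`.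

This is the input of the tame-sector certificate of the crux (order zero ⇒ the sandwich pair with exponent
`μ = 0` by iterated Schwarz; order zero ⇒ `NPointRegular`; the landed pointwise composition
`stub_planarInvariantOfInputsWeak`), filed separately.

References: K. Osterwalder, E. Seiler, Ann. Phys. 110 (1978) §2; J. Glimm, A. Jaffe, Quantum Physics (1987)
§6.1, Thm 10.5.5; K. Osterwalder, R. Schrader, Comm. Math. Phys. 31 (1973) §2.
-/

noncomputable section

open scoped SchwartzMap BigOperators
open MeasureTheory Filter Topology
open Literature.MathematicalPhysics.QuantumFieldTheory Literature.MathematicalPhysics.QuantumLattice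
open Literature.MathematicalPhysics.AQFT
open Literature.Probability.LatticeModels (box Site Torus.proj)
open Summit.QuantumFields.YangMills.Theorems.OSLegsFromFemtoAndGap (torusMoment)
open Summit.QuantumFields.YangMills.Theorems.CurvatureBoostCovariance.Negative
  (Tie W1 haarTraceRe proj_injOn_box eventually_lt_side)
open Summit.QuantumFields.YangMills.Theorems.NPointIsotropy.Negative (E4)
open Summit.QuantumFields.YangMills.Theorems.SoftKernelBoostCovariance.Sketch
  (riemannSum_trueDensity_eq_latticeSchwinger eventually_abs_renormalisedMean_le abs_trueDensity_le)
open Summit.QuantumFields.YangMills.Theorems.CurvatureDensities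
  (torusMoment_zero_coupling wilsonTorusMean_zero_coupling)
open Summit.QuantumFields.YangMills.Theorems.CurvatureBoostCovariance.BoostsInheritMirrors
  (stub_dominatedTieLimit)

namespace Summit.QuantumFields.YangMills.Theorems.SoftKernelBoostCovariance.Sketch.TameSector

variable {G : Type} [Group G] [TopologicalSpace G] [IsTopologicalGroup G] [CompactSpace G]
  [MeasurableSpace G] [BorelSpace G]

/-- **Domination by a constant weight from bounded tied densities (one degree).**  If lattice densities
`D_k` on `(ℤ⁴)ⁿ`, bounded by the constant `A` at injective multi-sites of the box for `k ≥ k₀`, have Riemann sums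
converging to `T F` on off-diagonal real tensors `F` (spacings `a_k → 0⁺`, `a_k L_k → ∞`), then
`‖T F‖ ≤ A ∫ ‖F‖` for EVERY `F ∈ ⁰𝒮` (the landed dominated tie limit with the constant weight). -/
theorem norm_le_const_mul_integral_of_bddDensity {n : ℕ} (hn : 0 < n) (T : 𝓢((Fin n → E4), ℂ) →L[ℂ] ℂ)
    (a : ℕ → ℝ) (L : ℕ → ℕ) (D : ℕ → (Fin n → Site 4) → ℝ) {A : ℝ} (hA : 0 ≤ A) (k₀ : ℕ)
    (ha : ∀ k, 0 < a k) (ha0 : Tendsto a atTop (𝓝 0)) (haL : Tendsto (fun k => a k * L k) atTop atTop)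
    (hD : ∀ k, k₀ ≤ k → ∀ x : Fin n → Site 4, (∀ i, x i ∈ box 4 (L k)) → Function.Injective x → |D k x| ≤ A)
    (htie : ∀ (f : Fin n → 𝓢(E4, ℝ)) (F : 𝓢((Fin n → E4), ℂ)),
      IsTensorOf F (fun i => ofRealTest (f i)) → IsOffDiagonal F →
      Tendsto (fun k => (((a k ^ 4) ^ n * ∑ x ∈ Fintype.piFinset (fun _ : Fin n => box 4 (L k)),
        (∏ i, f i (a k • siteToE (x i))) * D k x : ℝ) : ℂ)) atTop (𝓝 (T F)))
    (F : 𝓢((Fin n → E4), ℂ)) (hF : IsOffDiagonal F) : ‖T F‖ ≤ A * ∫ y, ‖F y‖ := by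
  have h := stub_dominatedTieLimit n hn T a L D (fun _ => A) A 0 k₀ ha ha0 haL measurable_const
    continuousOn_const (fun _ => hA) (fun y _ => by simp) (fun k hk x hx hinj => hD k hk x hx hinj) htie F hF
  calc ‖T F‖ ≤ ∫ y, ‖F y‖ * A := h.2
    _ = A * ∫ y, ‖F y‖ := by rw [integral_mul_const, mul_comm]

/-- **TIED FAMILIES ON THE TAME SECTOR ARE OF ORDER ZERO ON ALL OF `⁰𝒮`.**  Let `S₁` be tied to `(r, sch)`
(first clause of `W1`) and suppose that for some `B`, FREQUENTLY along the scheme, `β_k = 0` or `|c_k| ≤ B`.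
Then there is `A ≥ 0` such that `‖𝔖ₙ F‖ ≤ Aⁿ ∫ ‖F‖` for every degree `n ≥ 1` and every off-diagonal `F`
(all of `⁰𝒮`, complex-valued, not only tensors).  Along the subsequence of tame steps the true renormalised
densities `c_kⁿ W_k` are bounded by `Aⁿ` at injective multi-sites — `|κ_k|ⁿ` at zero coupling, `(2BM + K)ⁿ` at
bounded `c` — and their Riemann sums are the lattice `n`-point functions, so the dominated tie limit applies. -/
theorem norm_schwinger_le_of_frequently_tame (r : LatticeRep G) (sch : SpeciesScheme (YMSpecies G))
    (S₁ : SchwingerFamily E4) (htie : Tie r sch S₁)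
    (h : ∃ B : ℝ, ∃ᶠ k in atTop, sch.β k = 0 ∨ |sch.c r.curvature k| ≤ B) :
    ∃ A : ℝ, 0 ≤ A ∧ ∀ n : ℕ, n ≠ 0 → ∀ F : 𝓢((Fin n → E4), ℂ), IsOffDiagonal F →
      ‖S₁ n F‖ ≤ A ^ n * ∫ y, ‖F y‖ := by
  obtain ⟨B, hB⟩ := h
  obtain ⟨φ, hφ, hφP⟩ := extraction_of_frequently_atTop hB
  have hφt : Tendsto φ atTop atTop := hφ.tendsto_atTop
  -- the subsequence scheme along the tame steps
  let sch' : SpeciesScheme (YMSpecies G) :=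
    { a := fun k => sch.a (φ k)
      a_pos := fun k => sch.a_pos (φ k)
      tendsto_a := sch.tendsto_a.comp hφt
      β := fun k => sch.β (φ k)
      L := fun k => sch.L (φ k)
      tendsto_L := sch.tendsto_L.comp hφt
      c := fun s k => sch.c s (φ k)
      m := fun s k => sch.m s (φ k) }
  have hLS : ∀ (k n : ℕ) (f : Fin n → 𝓢(E4, ℝ)),
      latticeSchwinger r.ρ sch' (fun s => s.F) k n (fun _ => r.curvature) f =
        latticeSchwinger r.ρ sch (fun s => s.F) (φ k) n (fun _ => r.curvature) f := fun _ _ _ => rfl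
  have htie' : Tie r sch' S₁ := by
    intro n hn f F hF hF'
    refine ((htie n hn f F hF hF').comp hφt).congr fun k => ?_
    simp only [Function.comp_apply, hLS]
  obtain ⟨M, hM⟩ := r.curvature.bounded
  obtain ⟨K, hK⟩ := eventually_abs_renormalisedMean_le r sch' S₁ htie'
  obtain ⟨k₁, hk₁⟩ := eventually_atTop.1 hK
  -- the geometric constant
  set A : ℝ := |2 * B * M + K| + |K| + 1 with hAdef
  have hA1 : 1 ≤ A := by rw [hAdef]; linarith [abs_nonneg (2 * B * M + K), abs_nonneg K]
  have hA0 : 0 ≤ A := zero_le_one.trans hA1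
  have hKA : |K| ≤ A := by rw [hAdef]; linarith [abs_nonneg (2 * B * M + K)]
  have hBA : |2 * B * M + K| ≤ A := by rw [hAdef]; linarith [abs_nonneg K]
  refine ⟨A, hA0, fun n hn F hF => ?_⟩
  have hn' : 0 < n := Nat.pos_of_ne_zero hn
  obtain ⟨k₂, hk₂⟩ := eventually_atTop.1 (eventually_lt_side sch' n)
  -- the true renormalised densities along the subsequence scheme, bounded by `Aⁿ`
  set D : ℕ → (Fin n → Site 4) → ℝ := fun k x =>
    (sch'.c r.curvature k) ^ n * torusMoment r.ρ (sch'.β k) (sch'.L k) r.curvature.F (sch'.m r.curvature k) x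
    with hDdef
  have hDb : ∀ k, max k₁ k₂ ≤ k → ∀ x : Fin n → Site 4, (∀ i, x i ∈ box 4 (sch'.L k)) →
      Function.Injective x → |D k x| ≤ A ^ n := by
    intro k hk x hx hxinj
    have hk1 : k₁ ≤ k := (le_max_left _ _).trans hk
    have hk2 : k₂ ≤ k := (le_max_right _ _).trans hk
    rcases hφP k with hβ | hc
    · -- a zero-coupling step: the true density is the constant `κ_kⁿ`
      have hside : n < 2 * sch'.L k + 1 := hk₂ k hk2
      have hL : 0 < sch'.L k := by omega
      have hinj' : Function.Injective fun i => Torus.proj (2 * sch'.L k + 1) (x i) :=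
        fun i j hij => hxinj (proj_injOn_box (sch'.L k) (hx i) (hx j) hij)
      have hβ' : sch'.β k = 0 := hβ
      have hκ := hk₁ k hk1
      rw [hβ', wilsonTorusMean_zero_coupling r hL] at hκ
      simp only [hDdef]
      rw [hβ', torusMoment_zero_coupling r (sch'.L k) _ x hinj' hside, ← mul_pow, abs_pow]
      calc |sch'.c r.curvature k * (6 * haarTraceRe r.ρ - sch'.m r.curvature k)| ^ n
          ≤ |K| ^ n := pow_le_pow_left₀ (abs_nonneg _) (hκ.trans (le_abs_self K)) n
        _ ≤ A ^ n := pow_le_pow_left₀ (abs_nonneg _) hKA n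
    · -- a bounded-renormalisation step
      calc |D k x| ≤ (2 * B * M + K) ^ n := abs_trueDensity_le r sch' hM k hc (hk₁ k hk1) x
        _ ≤ |2 * B * M + K| ^ n := by rw [← abs_pow]; exact le_abs_self _
        _ ≤ A ^ n := pow_le_pow_left₀ (abs_nonneg _) hBA n
  -- the Riemann sums of the true densities are the lattice `n`-point functions: the tie
  have hRS : ∀ (f : Fin n → 𝓢(E4, ℝ)) (F : 𝓢((Fin n → E4), ℂ)),
      IsTensorOf F (fun i => ofRealTest (f i)) → IsOffDiagonal F →
      Tendsto (fun k => (((sch'.a k ^ 4) ^ n * ∑ x ∈ Fintype.piFinset (fun _ : Fin n => box 4 (sch'.L k)),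
        (∏ i, f i (sch'.a k • siteToE (x i))) * D k x : ℝ) : ℂ)) atTop (𝓝 (S₁ n F)) := by
    intro f F hF hF'
    refine (htie' n hn f F hF hF').congr fun k => ?_
    exact (riemannSum_trueDensity_eq_latticeSchwinger r sch' k n f F hF).symm
  exact norm_le_const_mul_integral_of_bddDensity hn' (S₁ n) sch'.a sch'.L D (pow_nonneg hA0 n) (max k₁ k₂)
    sch'.a_pos sch'.tendsto_a sch'.tendsto_L hDb hRS F hF

/-- **Order zero on the tame sector, from `W1`.**  For a family with the full curvature package `W1 r sch S₁`
(only its tie is used) along a scheme that is frequently at zero coupling or frequently of bounded multiplicative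
renormalisation: `‖𝔖ₙ F‖ ≤ Aⁿ ∫ ‖F‖` on `⁰𝒮`, all `n ≥ 1`. -/
theorem norm_schwinger_le_of_frequently_tame_of_W1 (r : LatticeRep G) (sch : SpeciesScheme (YMSpecies G))
    (S₁ : SchwingerFamily E4) (hW : W1 r sch S₁)
    (h : ∃ B : ℝ, ∃ᶠ k in atTop, sch.β k = 0 ∨ |sch.c r.curvature k| ≤ B) :
    ∃ A : ℝ, 0 ≤ A ∧ ∀ n : ℕ, n ≠ 0 → ∀ F : 𝓢((Fin n → E4), ℂ), IsOffDiagonal F →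
      ‖S₁ n F‖ ≤ A ^ n * ∫ y, ‖F y‖ :=
  norm_schwinger_le_of_frequently_tame r sch S₁ hW.1 h

/-- **Registered form (stub `stub_tameOrderZero` of crux stmt-QuantumFields-14999): ORDER ZERO ON THE TAME SECTOR.**
For every compact `G`, `r`, `sch`, `S₁` with the curvature package `W1 r sch S₁` (only the tie is used) along a
scheme that is frequently at zero coupling or frequently of bounded multiplicative renormalisation of the curvature
species: `‖𝔖ₙ F‖ ≤ Aⁿ ∫ ‖F‖` for some `A ≥ 0`, all `n ≥ 1` and all `F ∈ ⁰𝒮`. -/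
theorem stub_tameOrderZero :
    open Literature.MathematicalPhysics.QuantumLattice Literature.MathematicalPhysics.AQFT
      Literature.MathematicalPhysics.QuantumFieldTheory
      Summit.QuantumFields.YangMills.Theorems.CurvatureBoostCovariance.Negative
      Summit.QuantumFields.YangMills.Theorems.NPointIsotropy.Negative in
    ∀ (G : Type) [Group G] [TopologicalSpace G] [IsTopologicalGroup G] [CompactSpace G]
      [MeasurableSpace G] [BorelSpace G],
      ∀ (r : LatticeRep G) (sch : SpeciesScheme (YMSpecies G)) (S₁ : SchwingerFamily E4),
        W1 r sch S₁ → (∃ B : ℝ, ∃ᶠ k in Filter.atTop, sch.β k = 0 ∨ |sch.c r.curvature k| ≤ B) →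
        ∃ A : ℝ, 0 ≤ A ∧ ∀ n : ℕ, n ≠ 0 → ∀ F : SchwartzMap (Fin n → E4) ℂ, IsOffDiagonal F →
          ‖S₁ n F‖ ≤ A ^ n * ∫ y : Fin n → E4, ‖F y‖ :=
  fun _G _ _ _ _ _ _ r sch S₁ hW h => norm_schwinger_le_of_frequently_tame r sch S₁ hW.1 h

/-- **Contrapositive: a tied family that is NOT of order zero on `⁰𝒮` forces the wild sector** — the
multiplicative renormalisation tends to infinity in absolute value and the coupling is eventually non-zero. -/
theorem wildSector_of_not_orderZero (r : LatticeRep G) (sch : SpeciesScheme (YMSpecies G))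
    (S₁ : SchwingerFamily E4) (htie : Tie r sch S₁)
    (h : ¬ ∃ A : ℝ, 0 ≤ A ∧ ∀ n : ℕ, n ≠ 0 → ∀ F : 𝓢((Fin n → E4), ℂ), IsOffDiagonal F →
      ‖S₁ n F‖ ≤ A ^ n * ∫ y, ‖F y‖) :
    Tendsto (fun k => |sch.c r.curvature k|) atTop atTop ∧ ∀ᶠ k in atTop, sch.β k ≠ 0 := by
  constructor
  · by_contra hnot
    refine h (norm_schwinger_le_of_frequently_tame r sch S₁ htie ?_)
    rw [tendsto_atTop] at hnot
    obtain ⟨B, hB⟩ := not_forall.1 hnot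
    exact ⟨B, (not_eventually.1 hB).mono fun _ hk => Or.inr (not_le.1 hk).le⟩
  · by_contra hnot
    exact h (norm_schwinger_le_of_frequently_tame r sch S₁ htie
      ⟨0, (not_eventually.1 hnot).mono fun _ hk => Or.inl (not_not.1 hk)⟩)

end Summit.QuantumFields.YangMills.Theorems.SoftKernelBoostCovariance.Sketch.TameSector

end
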